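import Literature.AlgebraicGeometry.HodgeTheory.HypersurfaceResidueForms
import Literature.AlgebraicGeometry.HodgeTheory.HypersurfaceResidueFormNonzero
import Literature.NumberTheory.Transcendental.ProjectiveZeroLocusNonempty
import HarnessLib

/-!
# Discharge of `Voisin2003_hypersurface_residueForm` (proof file)

Sibling proof file of `Literature/AlgebraicGeometry/HodgeTheory/HypersurfaceResidueForms.lean`,
which vendors the named fact `Voisin2003_hypersurface_residueForm` (Griffiths' residue form of a
smooth hypersurface on a holomorphic model; Voisin II, §6.1.1, §6.1.3, Cor. 6.12 at `p = 1`).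
This file **discharges that fact** (`Voisin2003_hypersurface_residueForm_holds`) by assembling
the programme of `HypersurfaceConeResidue` (pointwise cone residue), `HypersurfaceResidueFormDef`
(the form `residueForm ψ F P = ψ^* Res_Y(PΩ/F)` and its local formula),
`HypersurfaceResidueFormHolomorphic` (holomorphy in charts) and `HypersurfaceResidueFormNonzero`
(non-vanishing): for `P = X_{i₀}^{d-m-2}` with `M_{i₀} ∋ x` (`M ≠ ∅` because the projective
hypersurface is non-empty, `Projectivization.projZeroLocus_singleton_nonempty`), the form is
holomorphic in charts and non-zero at `x`. Consequently the analytic geometric genus fact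
`Hartshorne1977_hypersurface_geometricGenus_pos` — and with it the original
`Hartshorne1977_hypersurface_exists_holomorphicTopForm` — now rests on the Jacobian criterion
`Hartshorne1977_smoothHypersurface_jacobian` alone (`Hartshorne1977_hypersurface_geometricGenus_pos_of_jacobian`,
`Hartshorne1977_hypersurface_exists_holomorphicTopForm_of_jacobian`).

## References

* C. Voisin, *Hodge Theory and Complex Algebraic Geometry II* (2003), §6.1.1, §6.1.3, Cor. 6.12.
* R. Hartshorne, *Algebraic Geometry* (1977), II Example 8.20.3.
-/

noncomputable section

open scoped Manifold ContDiff Topology LinearAlgebra.Projectivization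
open Set Projectivization

namespace Literature.AlgebraicGeometry.HodgeTheory

/-- **Discharge of `Voisin2003_hypersurface_residueForm`.** For `F` homogeneous of degree
`d ≥ m + 2` with non-vanishing gradient on its cone, and a compact Hausdorff complex `m`-manifold
`M` (holomorphic atlas on `E`, `dim_ℂ E = m`) embedded by `ψ` onto the projective zero locus of `F`
with holomorphic affine coordinates, the residue form `residueForm ψ F (X_{i₀}^{d-m-2})` is a
complex `m`-form holomorphic in charts (`isHolomorphicInCharts_residueForm`) and non-zero
(`residueForm_ne_zero` at a point `x ∈ M_{i₀}`; `M ≠ ∅` as the projective hypersurface is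
non-empty, `Projectivization.projZeroLocus_singleton_nonempty`). [cite: VoisinHodgeII2003, §6.1.1, §6.1.3 and Cor. 6.12 (p = 1)] -/
theorem Voisin2003_hypersurface_residueForm_holds : Voisin2003_hypersurface_residueForm := by
  intro m d hm hd F hF hjac E _ _ _ M _ _ _ _ _ _ hdim ψ hψ hrange hcoord
  have hhol : HasHolomorphicCoords E ψ := hcoord
  -- a point of `M`
  obtain ⟨p, hp⟩ := Projectivization.projZeroLocus_singleton_nonempty F hF (by omega)
  rw [← hrange] at hp
  obtain ⟨x, -⟩ := hp
  set i₀ := residueIdx ψ x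
  have hx : x ∈ liftDomain ψ i₀ := residueIdx_spec ψ x
  set P : MvPolynomial (Fin (m + 2)) ℂ := MvPolynomial.X i₀ ^ (d - (m + 2)) with hPdef
  have hP : P.IsHomogeneous (d - (m + 2)) := by
    simpa using (MvPolynomial.isHomogeneous_X ℂ i₀).pow (d - (m + 2))
  refine ⟨residueForm ψ F P,
    isHolomorphicInCharts_residueForm ψ hF hψ.continuous hrange.le hjac hhol hP hd, fun h0 ↦ ?_⟩
  exact residueForm_ne_zero ψ hF hψ hrange.le hjac hhol hdim hd hx (by rw [h0]; rfl)

/-- **The analytic geometric genus of smooth hypersurfaces from the Jacobian criterion alone**: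
`Hartshorne1977_hypersurface_geometricGenus_pos_of` with the residue-form fact discharged.
[cite: Hartshorne1977, II Example 8.20.3] -/
theorem Hartshorne1977_hypersurface_geometricGenus_pos_of_jacobian
    (h₁ : Hartshorne1977_smoothHypersurface_jacobian) : Hartshorne1977_hypersurface_geometricGenus_pos :=
  Hartshorne1977_hypersurface_geometricGenus_pos_of h₁ Voisin2003_hypersurface_residueForm_holds

/-- **`Hartshorne1977_hypersurface_exists_holomorphicTopForm` from the Jacobian criterion alone**
(the original named fact of `HypersurfaceHolomorphicForms`, through
`Hartshorne1977_hypersurface_exists_holomorphicTopForm_of_geometricGenus_pos`).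
[cite: Hartshorne1977, II Example 8.20.3] -/
theorem Hartshorne1977_hypersurface_exists_holomorphicTopForm_of_jacobian
    (h₁ : Hartshorne1977_smoothHypersurface_jacobian) :
    Hartshorne1977_hypersurface_exists_holomorphicTopForm :=
  Hartshorne1977_hypersurface_exists_holomorphicTopForm_of_geometricGenus_pos
    (Hartshorne1977_hypersurface_geometricGenus_pos_of_jacobian h₁)

end Literature.AlgebraicGeometry.HodgeTheory

end
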